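import Literature.Algebra.EuclideanLattices.GaussianSublatticeUniformity
import Literature.Probability.Distributions.IndepProductLawDistance
import Mathlib.Data.ZMod.Basic
import HarnessLib

/-!
# Nearly equal fibres push the uniform law to a nearly uniform law; reduction `mod d` and coarse rounding of a uniform integer

Topic `Probability/Distributions`. Quantitative companions of the tree's
`Literature.Probability.Distributions.map_uniformOfFintype_of_card_fiber` (all fibres EQUAL ⇒ the uniform
law is pushed to the uniform law), needed by bit-level reductions whose exact arithmetic cannot arrange
divisibility: a coin block of `ℓ` bits reduced modulo `d ∤ 2^ℓ` (sampling `ℤⁿ/T ℤⁿ` from a box), and the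
query rounding `k ↦ ⌊q (D k + r)/(D N)⌋` of the combining procedure of Micciancio–Regev 2007, Lemma 5.8,
when `q ∤ N` (the machine of the verifier-free route to
`Literature.Computability.Cryptography.owfExist_of_gapSVP_worstCaseHard`). Everything PROVED:

* `tvDist_map_uniformOfFintype_le_of_le_card_fiber` — if every fibre of `f : α → β` has at least `k`
  elements then `Δ(f_* U(α), U(β)) ≤ 1 - k|β|/|α|`; `…_le_card_div_card` — hence `≤ |β|/|α|` as soon as
  `(k + 1)|β| ≥ |α|` (fibres within one of the mean).
* `card_fiber_natMod_ge` / **`tvDist_map_natMod_uniform_le`** — for `x` uniform on `Fin M`,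
  `Δ(x mod d, U(ℤ/d)) ≤ d/M` (each residue class meets `[0, M)` in `≥ ⌊M/d⌋` points).
* `card_fiber_divRound_ge` / **`tvDist_map_divRound_uniform_le`** — for `k` uniform on `Fin N`, `r < D`,
  `q ≤ N`: `Δ(⌊q(Dk + r)/(DN)⌋ mod q, U(ℤ/q)) ≤ q/N` (each value is taken on the integers of a real
  interval of length `N/q`, hence `≥ ⌊N/q⌋` times).

## References

* D. Micciancio, O. Regev, *Worst-case to average-case reductions based on Gaussian measures*,
  SIAM J. Comput. 37 (2007), Lemma 5.8 (i) ("it easily follows that `A` is distributed uniformly").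
* O. Goldreich, *Foundations of Cryptography I*, CUP 2001, §3.2.1 (statistical distance) [Goldreich2001].
-/

noncomputable section

namespace Literature.Probability.Distributions

open Finset
open scoped ENNReal

variable {α β : Type*} [Fintype α] [Nonempty α] [Fintype β] [Nonempty β] [DecidableEq β]

/-! ### Fibres of size at least `k` -/

omit [Fintype β] [Nonempty β] in
/-- The mass of a point under the push-forward of the uniform law: `|f⁻¹(b)|/|α|`. [folklore] -/
theorem toReal_map_uniformOfFintype_apply (f : α → β) (b : β) :
    (((PMF.uniformOfFintype α).map f) b).toReal = ((univ.filter fun a => f a = b).card : ℝ) / Fintype.card α := by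
  classical
  rw [PMF.map_apply, tsum_fintype]
  simp_rw [PMF.uniformOfFintype_apply]
  rw [Finset.sum_ite, Finset.sum_const_zero, add_zero, sum_const, nsmul_eq_mul, ENNReal.toReal_mul,
    ENNReal.toReal_natCast, ENNReal.toReal_inv, ENNReal.toReal_natCast, div_eq_mul_inv]
  have hfilter : (univ.filter fun a => b = f a).card = (univ.filter fun a => f a = b).card := by
    congr 1; ext a; simp [eq_comm]
  rw [hfilter]

/-- **Fibres of size at least `k` give a nearly uniform push-forward**:
`Δ(f_* U(α), U(β)) ≤ 1 - k|β|/|α|`. [cite: Goldreich2001, §3.2.1] -/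
theorem tvDist_map_uniformOfFintype_le_of_le_card_fiber (f : α → β) (k : ℕ)
    (h : ∀ b, k ≤ (univ.filter fun a => f a = b).card) :
    ((PMF.uniformOfFintype α).map f).tvDist (PMF.uniformOfFintype β) ≤
      1 - k * Fintype.card β / Fintype.card α := by
  set p : β → ℝ := fun b => (((PMF.uniformOfFintype α).map f) b).toReal with hp
  have hA : (0 : ℝ) < Fintype.card α := by exact_mod_cast Fintype.card_pos
  have hB : (0 : ℝ) < Fintype.card β := by exact_mod_cast Fintype.card_pos
  have hp1 : ∑ b, p b = 1 := by
    have := PMF.tsum_coe_toReal ((PMF.uniformOfFintype α).map f)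
    rwa [tsum_fintype] at this
  set δ : ℝ := 1 - k * Fintype.card β / Fintype.card α with hδ
  have hlow : ∀ b, (1 - δ) / Fintype.card β ≤ p b := by
    intro b
    have hpb : p b = ((univ.filter fun a => f a = b).card : ℝ) / Fintype.card α := toReal_map_uniformOfFintype_apply f b
    rw [hpb, hδ, sub_sub_cancel]
    have e : (k : ℝ) * Fintype.card β / Fintype.card α / Fintype.card β = k / Fintype.card α := by
      field_simp
    rw [e]
    gcongr
    exact_mod_cast h b
  have hsum := Literature.Algebra.EuclideanLattices.sum_abs_sub_inv_card_le hp1 hlow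
  unfold PMF.tvDist
  rw [tsum_fintype]
  have heq : ∑ b, |(((PMF.uniformOfFintype α).map f) b).toReal - ((PMF.uniformOfFintype β) b).toReal| =
      ∑ b, |p b - (Fintype.card β : ℝ)⁻¹| := by
    refine Finset.sum_congr rfl fun b _ => ?_
    simp [hp, PMF.uniformOfFintype_apply]
  rw [heq]
  linarith

/-- **Fibres within one of the mean**: if every fibre has at least `k` elements and `(k + 1)|β| ≥ |α|`,
then `Δ(f_* U(α), U(β)) ≤ |β|/|α|`. [cite: Goldreich2001, §3.2.1] -/
theorem tvDist_map_uniformOfFintype_le_card_div_card (f : α → β) (k : ℕ)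
    (h : ∀ b, k ≤ (univ.filter fun a => f a = b).card) (hk : Fintype.card α ≤ (k + 1) * Fintype.card β) :
    ((PMF.uniformOfFintype α).map f).tvDist (PMF.uniformOfFintype β) ≤ (Fintype.card β : ℝ) / Fintype.card α := by
  refine (tvDist_map_uniformOfFintype_le_of_le_card_fiber f k h).trans ?_
  have hA : (0 : ℝ) < Fintype.card α := by exact_mod_cast Fintype.card_pos
  have hk' : (Fintype.card α : ℝ) ≤ (k + 1) * Fintype.card β := by exact_mod_cast hk
  have hiff : (1 : ℝ) - k * Fintype.card β / Fintype.card α ≤ Fintype.card β / Fintype.card α ↔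
      (Fintype.card α : ℝ) ≤ k * Fintype.card β + Fintype.card β := by
    rw [sub_le_iff_le_add, ← add_div, le_div_iff₀ hA, one_mul, add_comm]
  exact hiff.2 (by linarith)

/-! ### Reduction modulo `d` of a uniform element of `[0, M)` -/

/-- **Each residue class modulo `d` meets `[0, M)` in at least `⌊M/d⌋` points** (`a + d t`, `t < ⌊M/d⌋`).
[folklore] -/
theorem card_fiber_natMod_ge (M d : ℕ) [NeZero d] (a : ZMod d) :
    M / d ≤ (univ.filter fun x : Fin M => ((x : ℕ) : ZMod d) = a).card := by
  -- the injection `t ↦ a.val + d t`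
  have hd : 0 < d := Nat.pos_of_ne_zero (NeZero.ne d)
  have hval : a.val < d := ZMod.val_lt a
  let g : Fin (M / d) → Fin M := fun t => ⟨a.val + d * t, by
    have ht := t.isLt
    have h1 : a.val + d * (t : ℕ) < d + d * (M / d - 1) := by
      have : d * (t : ℕ) ≤ d * (M / d - 1) := Nat.mul_le_mul_left _ (by omega)
      omega
    have h2 : d + d * (M / d - 1) = d * (M / d) := by
      have : 1 ≤ M / d := by omega
      calc d + d * (M / d - 1) = d * 1 + d * (M / d - 1) := by ring
        _ = d * (1 + (M / d - 1)) := by ring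
        _ = d * (M / d) := by congr 1; omega
    have h3 : d * (M / d) ≤ M := Nat.mul_div_le M d
    omega⟩
  have hg : Function.Injective g := by
    intro t t' h
    have := congrArg Fin.val h
    simp only [g] at this
    exact Fin.ext (Nat.eq_of_mul_eq_mul_left hd (by omega))
  calc M / d = (univ.image g).card := by rw [Finset.card_image_of_injective _ hg, card_univ, Fintype.card_fin]
    _ ≤ _ := Finset.card_le_card fun x hx => ?_
  simp only [mem_image, mem_univ, true_and] at hx
  obtain ⟨t, rfl⟩ := hx
  simp only [mem_filter, mem_univ, true_and, g]
  push_cast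
  rw [ZMod.natCast_self, zero_mul, add_zero, ZMod.natCast_zmod_val]

/-- **A uniform element of `[0, M)` reduced modulo `d` is within `d/M` of uniform on `ℤ/d`** (exactly
uniform when `d ∣ M`). [cite: Goldreich2001, §3.2.1] -/
theorem tvDist_map_natMod_uniform_le (M d : ℕ) [NeZero M] [NeZero d] :
    ((PMF.uniformOfFintype (Fin M)).map fun x : Fin M => ((x : ℕ) : ZMod d)).tvDist (PMF.uniformOfFintype (ZMod d)) ≤
      (d : ℝ) / M := by
  have h := tvDist_map_uniformOfFintype_le_card_div_card (α := Fin M) (β := ZMod d)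
    (fun x : Fin M => ((x : ℕ) : ZMod d)) (M / d) (card_fiber_natMod_ge M d) (by
      rw [Fintype.card_fin, ZMod.card]
      have hd : 0 < d := Nat.pos_of_ne_zero (NeZero.ne d)
      have := Nat.div_add_mod M d
      have := Nat.mod_lt M hd
      nlinarith)
  simpa [ZMod.card] using h

/-! ### Coarse rounding of a uniform element of `[0, N)`: `k ↦ ⌊q(Dk + r)/(DN)⌋` -/

/-- The value `⌊q(Dk + r)/(DN)⌋` is below `q` for `k < N`, `r < D`. [folklore] -/
theorem divRound_lt {q D N r : ℕ} (hD : 0 < D) (hN : 0 < N) (hr : r < D) {k : ℕ} (hk : k < N) :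
    q * (D * k + r) / (D * N) < q ⊔ 1 := by
  rcases Nat.eq_zero_or_pos q with rfl | hq
  · simp
  · refine lt_of_lt_of_le ((Nat.div_lt_iff_lt_mul (by positivity)).2 ?_) (le_max_left _ _)
    have : D * k + r < D * N := by
      calc D * k + r < D * k + D := by omega
        _ = D * (k + 1) := by ring
        _ ≤ D * N := Nat.mul_le_mul_left _ hk
    calc q * (D * k + r) < q * (D * N) := Nat.mul_lt_mul_of_pos_left this hq
      _ = q * (D * N) := rfl

/-- **Each value of the coarse rounding is taken at least `⌊N/q⌋` times**: for `A < q ≤ N`, `r < D`, the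
`k < N` with `⌊q(Dk + r)/(DN)⌋ = A` include all integers of the real interval
`[AN/q - r/D, (A+1)N/q - r/D)`, of length `N/q`. [folklore] -/
theorem card_fiber_divRound_ge {q D N r : ℕ} (hq : 0 < q) (hqN : q ≤ N) (hD : 0 < D) (hr : r < D) (A : ℕ) (hA : A < q) :
    N / q ≤ (univ.filter fun k : Fin N => q * (D * (k : ℕ) + r) / (D * N) = A).card := by
  have hN : 0 < N := hq.trans_le hqN
  -- the real interval and its integer points
  set αr : ℝ := (A : ℝ) * N / q - r / D with hαr
  set L : ℝ := (N : ℝ) / q with hL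
  have hq' : (0 : ℝ) < q := by exact_mod_cast hq
  have hD' : (0 : ℝ) < D := by exact_mod_cast hD
  have hN' : (0 : ℝ) < N := by exact_mod_cast hN
  have hαlow : -1 < αr := by
    rw [hαr]
    have h1 : (0 : ℝ) ≤ (A : ℝ) * N / q := by positivity
    have h2 : (r : ℝ) / D < 1 := by rw [div_lt_one hD']; exact_mod_cast hr
    linarith
  have hαup : αr + L ≤ N := by
    have h1 : ((A : ℝ) + 1) ≤ q := by exact_mod_cast Nat.succ_le_of_lt hA
    have h2 : (0 : ℝ) ≤ r / D := by positivity
    have h3 : ((A : ℝ) + 1) * N / q ≤ N := by rw [div_le_iff₀ hq']; nlinarith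
    have e : αr + L = ((A : ℝ) + 1) * N / q - r / D := by rw [hαr, hL]; ring
    linarith
  -- an integer `k` with `αr ≤ k < αr + L` lies in `[0, N)` and in the fibre
  have hmem : ∀ k : ℤ, αr ≤ k → (k : ℝ) < αr + L → ∃ hk : 0 ≤ k ∧ k.toNat < N,
      q * (D * k.toNat + r) / (D * N) = A := by
    intro k hk1 hk2
    have hk0 : 0 ≤ k := by
      have : (-1 : ℝ) < k := hαlow.trans_le hk1
      have : (-1 : ℤ) < k := by exact_mod_cast this
      omega
    have hkN : k.toNat < N := by
      have : (k : ℝ) < N := hk2.trans_le hαup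
      have hk' : ((k.toNat : ℕ) : ℝ) = (k : ℝ) := by
        rw [show ((k.toNat : ℕ) : ℝ) = ((k.toNat : ℤ) : ℝ) by norm_cast, Int.toNat_of_nonneg hk0]
      have : ((k.toNat : ℕ) : ℝ) < N := by rw [hk']; exact this
      exact_mod_cast this
    refine ⟨⟨hk0, hkN⟩, ?_⟩
    have hk' : ((k.toNat : ℕ) : ℝ) = (k : ℝ) := by
      rw [show ((k.toNat : ℕ) : ℝ) = ((k.toNat : ℤ) : ℝ) by norm_cast, Int.toNat_of_nonneg hk0]
    -- `A · (DN) ≤ q(Dk + r) < (A + 1) · (DN)`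
    have hlow : (A : ℝ) * (D * N) ≤ q * (D * k.toNat + r) := by
      rw [hk']
      have := hk1
      rw [hαr, sub_le_iff_le_add, div_le_iff₀ hq'] at this
      have h2 : ((k : ℝ) + r / D) * q * D = q * (D * k + r) := by field_simp
      nlinarith [mul_le_mul_of_nonneg_right this hD'.le]
    have hup : (q : ℝ) * (D * k.toNat + r) < (A + 1) * (D * N) := by
      rw [hk']
      have := hk2
      rw [hαr, hL, show (A : ℝ) * N / q - r / D + N / q = (A + 1) * N / q - r / D by ring, lt_sub_iff_add_lt,
        lt_div_iff₀ hq'] at this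
      have h2 : ((k : ℝ) + r / D) * q * D = q * (D * k + r) := by field_simp
      nlinarith [mul_lt_mul_of_pos_right this hD']
    exact Nat.div_eq_of_lt_le (by exact_mod_cast hlow) (by exact_mod_cast hup)
  -- the injection from the integer points of the interval into the fibre
  set a₀ : ℤ := ⌈αr⌉ with ha₀
  set cq : ℕ := N / q with hcq
  have hcount : cq ≤ (⌈αr + L⌉ - ⌈αr⌉).toNat := by
    have h1 : ⌈αr⌉ + (cq : ℤ) ≤ ⌈αr + L⌉ := by
      have hfl : (cq : ℝ) ≤ L := by
        rw [hL, le_div_iff₀ hq', hcq]; exact_mod_cast Nat.div_mul_le_self N q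
      calc ⌈αr⌉ + (cq : ℤ) = ⌈αr + ((cq : ℤ) : ℝ)⌉ := (Int.ceil_add_intCast αr _).symm
        _ ≤ ⌈αr + L⌉ := Int.ceil_le_ceil (by rw [Int.cast_natCast]; linarith)
    omega
  let g : Fin cq → Fin N := fun t =>
    ⟨(a₀ + t).toNat, (hmem (a₀ + t) (by
        have := Int.le_ceil αr; push_cast; linarith [show (0:ℝ) ≤ (t : ℕ) from Nat.cast_nonneg _])
      (by
        have ht : ((t : ℕ) : ℤ) < ⌈αr + L⌉ - ⌈αr⌉ := by have := t.isLt; omega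
        have ht' : ((a₀ + t : ℤ) : ℝ) < ((⌈αr + L⌉ : ℤ) : ℝ) := by
          have : a₀ + t < ⌈αr + L⌉ := by omega
          exact_mod_cast this
        have := Int.ceil_lt_add_one (αr + L)
        -- `k < ⌈x⌉ ⇒ k < x` for integers `k`... via `Int.lt_ceil`
        have hlt : ((a₀ + t : ℤ) : ℝ) < αr + L := Int.lt_ceil.1 (by exact_mod_cast (show a₀ + t < ⌈αr + L⌉ by omega))
        exact hlt)).1.2⟩
  have hg_inj : Function.Injective g := by
    intro t t' h
    have h' := congrArg Fin.val h
    simp only [g] at h'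
    have h0 : ∀ s : Fin cq, 0 ≤ a₀ + s := fun s => by
      have := (hmem (a₀ + s) (by have := Int.le_ceil αr; push_cast; linarith [show (0:ℝ) ≤ (s : ℕ) from Nat.cast_nonneg _])
        (Int.lt_ceil.1 (by have := s.isLt; exact_mod_cast (show a₀ + s < ⌈αr + L⌉ by omega)))).1.1
      exact this
    have := congrArg (fun x : ℕ => (x : ℤ)) h'
    simp only [Int.toNat_of_nonneg (h0 t), Int.toNat_of_nonneg (h0 t')] at this
    exact Fin.ext (by omega)
  calc cq = (univ.image g).card := by rw [Finset.card_image_of_injective _ hg_inj, card_univ, Fintype.card_fin]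
    _ ≤ _ := Finset.card_le_card fun x hx => ?_
  simp only [mem_image, mem_univ, true_and] at hx
  obtain ⟨t, rfl⟩ := hx
  simp only [mem_filter, mem_univ, true_and, g]
  exact (hmem (a₀ + t) (by have := Int.le_ceil αr; push_cast; linarith [show (0:ℝ) ≤ (t : ℕ) from Nat.cast_nonneg _])
    (Int.lt_ceil.1 (by have := t.isLt; exact_mod_cast (show a₀ + t < ⌈αr + L⌉ by omega)))).2

/-- **The coarse rounding of a uniform element of `[0, N)` is within `q/N` of uniform on `ℤ/q`**: for
`k` uniform on `Fin N`, `r < D` and `1 ≤ q ≤ N`, the class of `⌊q(Dk + r)/(DN)⌋` in `ℤ/q` is within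
statistical distance `q/N` of uniform (exactly uniform when `q ∣ N` and `r = 0`). This is the rounding
step `aᵢ = ⌊q S⁻¹ wᵢ⌋` of MR07's combining procedure read on ONE coset of the coarse grid.
[cite: MicciancioRegev2007, Lemma 5.8 (i)] -/
theorem tvDist_map_divRound_uniform_le {q D N r : ℕ} [NeZero q] [NeZero N] (hqN : q ≤ N) (hD : 0 < D) (hr : r < D) :
    ((PMF.uniformOfFintype (Fin N)).map fun k : Fin N => ((q * (D * (k : ℕ) + r) / (D * N) : ℕ) : ZMod q)).tvDist
        (PMF.uniformOfFintype (ZMod q)) ≤ (q : ℝ) / N := by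
  have hq : 0 < q := Nat.pos_of_ne_zero (NeZero.ne q)
  have hN : 0 < N := hq.trans_le hqN
  have hfib : ∀ b : ZMod q, N / q ≤ (univ.filter fun k : Fin N => ((q * (D * (k : ℕ) + r) / (D * N) : ℕ) : ZMod q) = b).card := by
    intro b
    refine (card_fiber_divRound_ge hq hqN hD hr b.val (ZMod.val_lt b)).trans (Finset.card_le_card fun k hk => ?_)
    simp only [mem_filter, mem_univ, true_and] at hk ⊢
    rw [hk, ZMod.natCast_zmod_val]
  have h := tvDist_map_uniformOfFintype_le_card_div_card (α := Fin N) (β := ZMod q) _ (N / q) hfib (by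
    rw [Fintype.card_fin, ZMod.card]
    have := Nat.div_add_mod N q
    have := Nat.mod_lt N hq
    nlinarith)
  simpa [ZMod.card] using h

end Literature.Probability.Distributions

end
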